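import Summits.NavierStokesRegularity.NavierStokesRegularity.Theorems.AdaptedFrequencyFrequencyRigidityKernelPairingLemmas
import Literature.Analysis.FluidPDE.ParabolicHarnackDriftRefutation

/-!
# Crux `AdaptedKernelExists` (stmt-NavierStokesRegularity-2956), line `nash-entropy-last-block`:
  the PAIRING IDENTITY and the TEST FUNCTIONS for STUB `stub_expMoment`

Helper file (lands `--supports stmt-NavierStokesRegularity-2956`) for the registered stub
`stub_expMoment` of the line's skeleton (the exponential moment law
`∫ e^{⟨α, x − x₀⟩} G(t, x) dx ≤ exp(ν‖α‖²(T − t) + 2C‖α‖√(T − t))` for an adapted backward kernel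
`G` of `∂ₜ + b·∇ − νΔ` of a Type-I divergence-free drift). This file carries, for a general
finite-dimensional real inner product space `E`:

* `expMoment_pairing`: for a time-INDEPENDENT test function `φ ∈ C²_c(E)`, an open time set `S`,
  a jointly smooth divergence-free drift `v` and an adapted backward kernel `K` on `S`,
  `d/ds ∫ φ K(s) = ∫ (Dφ·v(s) − νΔφ) K(s)` (differentiation under the integral sign, the adjoint
  equation with a two-sided time derivative at interior times, the transport integration by parts
  with `div v = 0` and Green's second identity of the tree's kernel-pairing lemmas
  `…Theorems.AdaptedFrequencyFrequencyRigidityKernelPairingLemmas`): transport drops out exactly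
  and no derivative of `K` survives;
* the cut-off exponential test functions `φ_R(x) = χ_R(x − x₀) e^{⟨α, x − x₀⟩}` (`χ_R = cutoff R`
  of the tree): smoothness, support, value at the pole, gradient and Laplacian, and the pointwise
  lower bound `Dφ_R(x)·w − νΔφ_R(x) ≥ −(‖α‖‖w‖ + ν‖α‖²) φ_R(x) − e^{⟨α, x − x₀⟩}
  (‖Dχ_R‖(‖w‖ + 2ν‖α‖) + ν|Δχ_R|)(x − x₀)`, whose error term lives on the annulus
  `R ≤ ‖x − x₀‖ ≤ 2R`;
* `expMoment_stub_pairing`: the `ℝ³` form of the pairing identity, the registered sub-goal of the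
  crux item for this helper file.

Companion files: `…ExpMomentEnvelope` (Gaussian envelope estimates, ODE comparison) and
`…ExpMoment` (the stub).
-/

noncomputable section

open MeasureTheory Set Filter Topology Metric Function
open scoped Laplacian ContDiff RealInnerProductSpace
open Literature.Analysis.FluidPDE

namespace Summit.NavierStokesRegularity.NavierStokesRegularity.Theorems.AdaptedKernelExists.NashEntropyLastBlock

variable {E : Type*} [NormedAddCommGroup E] [InnerProductSpace ℝ E] [FiniteDimensional ℝ E]
  [MeasurableSpace E] [BorelSpace E]

/-! ### The pairing identity for a time-independent test function -/

open Summit.NavierStokesRegularity.NavierStokesRegularity.Theorems.FrequencyRigidity.TwoEndedPinning in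
/-- **Pairing identity, time-independent test function.** Let `S` be an open time set, `v` a
jointly smooth divergence-free drift on `S`, `K` an adapted backward kernel of `∂ₜ + v·∇ − νΔ`
on `S`, and `φ ∈ C²_c(E)`. Then for `t ∈ S` the integrand `(Dφ·v(t) − νΔφ) K(t)` is integrable
and `d/ds ∫ φ K(s) |_{s = t} = ∫ (Dφ·v(t) − νΔφ) K(t)`: differentiate under the integral sign,
substitute the adjoint equation for `∂ₜK`, and integrate by parts (`∫ φ DK·v = −∫ Dφ·v K` by
`div v = 0`, `∫ φ ΔK = ∫ Δφ K` by Green), so that the transport term drops out exactly. -/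
theorem expMoment_pairing {ν : ℝ} {v : ℝ → E → E} {S : Set ℝ} (hS : IsOpen S) {T : ℝ} {x₀ : E}
    {K : ℝ → E → ℝ} {φ : E → ℝ} (hv : IsSmoothSpaceTimeOn S v)
    (hdiv : ∀ t ∈ S, VectorCalculus.IsDivFree (v t)) (hK : IsAdaptedBackwardKernel ν v S T x₀ K)
    (hφ : ContDiff ℝ 2 φ) (hφc : HasCompactSupport φ) {t : ℝ} (ht : t ∈ S) :
    Integrable (fun x => (fderiv ℝ φ x (v t x) - ν * (Δ φ) x) * K t x) ∧
      HasDerivAt (fun s => ∫ x, φ x * K s x)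
        (∫ x, (fderiv ℝ φ x (v t x) - ν * (Δ φ) x) * K t x) t := by
  have hSt : S ∈ 𝓝 t := hS.mem_nhds ht
  have hk2 : ContDiff ℝ 2 (K t) := hK.contDiff_slice ht
  have hk1 : ContDiff ℝ 1 (K t) := hk2.of_le one_le_two
  have hp1 : ContDiff ℝ 1 φ := hφ.of_le one_le_two
  have hV1 : ContDiff ℝ 1 (v t) := contDiff_infty.1 (hv.contDiff_slice ht) 1
  -- integrable pairings (continuous, compactly supported)
  have iB : Integrable fun x => φ x * fderiv ℝ (K t) x (v t x) :=
    (hφ.continuous.mul ((hk1.continuous_fderiv one_ne_zero).clm_apply hV1.continuous))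
      |>.integrable_of_hasCompactSupport hφc.mul_right
  have iC : Integrable fun x => φ x * (Δ (K t)) x :=
    (hφ.continuous.mul (continuous_laplacian hk2)).integrable_of_hasCompactSupport hφc.mul_right
  have iD : Integrable fun x => fderiv ℝ φ x (v t x) * K t x := by
    have hc : HasCompactSupport fun x => fderiv ℝ φ x (v t x) * K t x :=
      HasCompactSupport.intro hφc.isCompact fun x hx => by
        rw [fderiv_of_notMem_tsupport ℝ hx]; simp
    exact (((hp1.continuous_fderiv one_ne_zero).clm_apply hV1.continuous).mul hk1.continuous)
      |>.integrable_of_hasCompactSupport hc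
  have iE : Integrable fun x => (Δ φ) x * K t x := by
    have hc : HasCompactSupport fun x => (Δ φ) x * K t x :=
      HasCompactSupport.intro hφc.isCompact fun x hx => by
        rw [laplacian_eq_zero_of_notMem_tsupport hx, zero_mul]
    exact ((continuous_laplacian hφ).mul hk1.continuous).integrable_of_hasCompactSupport hc
  have iEν : Integrable fun x => ν * ((Δ φ) x * K t x) := iE.const_mul ν
  have iCν : Integrable fun x => ν * (φ x * (Δ (K t)) x) := iC.const_mul ν
  have heq : (fun x => (fderiv ℝ φ x (v t x) - ν * (Δ φ) x) * K t x) =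
      fun x => fderiv ℝ φ x (v t x) * K t x - ν * ((Δ φ) x * K t x) := by
    funext x; ring
  refine ⟨by rw [heq]; exact iD.sub iEν, ?_⟩
  -- Step 1: differentiate under the integral sign
  have hΦ : ContDiffOn ℝ 1 (uncurry fun s x => φ x * K s x) (S ×ˢ univ) :=
    (hp1.comp contDiff_snd).contDiffOn.mul (hK.contDiffOn.of_le one_le_two)
  have hΦsupp : ∀ s ∈ S, ∀ x ∉ tsupport φ, φ x * K s x = 0 := fun s _ x hx => by
    rw [image_eq_zero_of_notMem_tsupport hx, zero_mul]
  have step1 := hasDerivAt_integral_of_contDiffOn (μ := volume) hS hΦ hφc.isCompact hΦsupp ht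
  -- Step 2: the pointwise time derivative through the adjoint equation
  have hderiv : ∀ x, deriv (fun s => φ x * K s x) t =
      φ x * -(fderiv ℝ (K t) x (v t x) + ν * (Δ (K t)) x) := fun x =>
    ((kernelPairing_hasDerivAt_kernel hK hSt x).const_mul (φ x)).deriv
  refine step1.congr_deriv ?_
  -- Step 3: integrate by parts
  have hibp1 := kernelPairing_integral_mul_fderiv_apply_eq_neg hp1 hk1 hV1 (hdiv t ht) hφc
  have hibp2 : ∫ x, φ x * (Δ (K t)) x = ∫ x, (Δ φ) x * K t x :=
    calc ∫ x, φ x * (Δ (K t)) x = ∫ x, (Δ (K t)) x * φ x :=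
          integral_congr_ae (Eventually.of_forall fun x => mul_comm _ _)
      _ = ∫ x, K t x * (Δ φ) x := (integral_mul_laplacian_eq_integral_laplacian_mul hk2 hφ hφc).symm
      _ = ∫ x, (Δ φ) x * K t x := integral_congr_ae (Eventually.of_forall fun x => mul_comm _ _)
  have iBn : Integrable (fun x => -(φ x * fderiv ℝ (K t) x (v t x))) := iB.neg
  have hR : ∫ x, (fderiv ℝ φ x (v t x) - ν * (Δ φ) x) * K t x =
      -(∫ x, φ x * fderiv ℝ (K t) x (v t x)) - ν * ∫ x, φ x * (Δ (K t)) x := by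
    rw [heq, integral_sub iD iEν, integral_const_mul, hibp1, hibp2, neg_neg]
  have hL : ∫ x, deriv (fun s => φ x * K s x) t =
      -(∫ x, φ x * fderiv ℝ (K t) x (v t x)) - ν * ∫ x, φ x * (Δ (K t)) x := by
    rw [← integral_neg, ← integral_const_mul, ← integral_sub iBn iCν]
    exact integral_congr_ae (Eventually.of_forall fun x => by beta_reduce; rw [hderiv x]; ring)
  exact hL.trans hR.symm

/-! ### The cut-off exponential test functions -/

omit [FiniteDimensional ℝ E] [MeasurableSpace E] [BorelSpace E] in
/-- The derivative of the exponential weight `y ↦ e^{⟨α, y − x₀⟩}`: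
`D(x) = e^{⟨α, x − x₀⟩} ⟨α, ·⟩`. -/
theorem expMoment_hasFDerivAt_exp_inner (α x₀ x : E) :
    HasFDerivAt (fun y : E => Real.exp ⟪α, y - x₀⟫) (Real.exp ⟪α, x - x₀⟫ • innerSL ℝ α) x := by
  have hi : HasFDerivAt (fun y : E => ⟪α, y - x₀⟫) (innerSL ℝ α) x :=
    (hasFDerivAt_comp_sub x₀).2 (innerSL ℝ α).hasFDerivAt
  exact hi.exp

omit [FiniteDimensional ℝ E] [MeasurableSpace E] [BorelSpace E] in
/-- The exponential weight is smooth. -/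
theorem expMoment_contDiff_exp_inner (α x₀ : E) {n : WithTop ℕ∞} :
    ContDiff ℝ n (fun y : E => Real.exp ⟪α, y - x₀⟫) :=
  Real.contDiff_exp.comp (contDiff_const.inner ℝ (contDiff_id.sub contDiff_const))

omit [MeasurableSpace E] [BorelSpace E] in
/-- The Laplacian of the exponential weight: `Δ e^{⟨α, · − x₀⟩} = ‖α‖² e^{⟨α, · − x₀⟩}`
(the tree's plane-wave Laplacian `laplacian_exp_mul_exp_inner`). -/
theorem expMoment_laplacian_exp_inner (α x₀ x : E) :
    (Δ (fun y : E => Real.exp ⟪α, y - x₀⟫)) x = ‖α‖ ^ 2 * Real.exp ⟪α, x - x₀⟫ := by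
  have heq : (fun y : E => Real.exp ⟪α, y - x₀⟫) =
      fun y => Real.exp (-⟪α, x₀⟫) * Real.exp (1 * ⟪α, y⟫) := by
    funext y
    rw [← Real.exp_add, inner_sub_right]
    congr 1; ring
  rw [heq, laplacian_exp_mul_exp_inner α 1 (-⟪α, x₀⟫) x, ← Real.exp_add, inner_sub_right,
    show ⟪α, x⟫ - ⟪α, x₀⟫ = -⟪α, x₀⟫ + 1 * ⟪α, x⟫ by ring]
  ring

omit [FiniteDimensional ℝ E] [MeasurableSpace E] [BorelSpace E] in
/-- The cut-off exponential test function `φ_R(x) = χ_R(x − x₀) e^{⟨α, x − x₀⟩}` is smooth. -/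
theorem expMoment_test_contDiff (R : ℝ) (α x₀ : E) {n : ℕ∞} :
    ContDiff ℝ n (fun x : E => cutoff R (x - x₀) * Real.exp ⟪α, x - x₀⟫) :=
  ((contDiff_cutoff R).comp (contDiff_id.sub contDiff_const)).mul
    (expMoment_contDiff_exp_inner α x₀)

omit [FiniteDimensional ℝ E] [MeasurableSpace E] [BorelSpace E] in
/-- The test function vanishes off the closed ball `B̄(x₀, 2R)` (`R > 0`). -/
theorem expMoment_test_eq_zero {R : ℝ} (hR : 0 < R) (α x₀ : E) {x : E}
    (hx : x ∉ closedBall x₀ (2 * R)) : cutoff R (x - x₀) * Real.exp ⟪α, x - x₀⟫ = 0 := by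
  rw [mem_closedBall, dist_eq_norm, not_le] at hx
  rw [cutoff_eq_zero hR hx.le, zero_mul]

omit [MeasurableSpace E] [BorelSpace E] in
/-- The test function has compact support (`R > 0`). -/
theorem expMoment_test_hasCompactSupport {R : ℝ} (hR : 0 < R) (α x₀ : E) :
    HasCompactSupport (fun x : E => cutoff R (x - x₀) * Real.exp ⟪α, x - x₀⟫) :=
  HasCompactSupport.intro (isCompact_closedBall x₀ (2 * R)) fun _ hx =>
    expMoment_test_eq_zero hR α x₀ hx

omit [FiniteDimensional ℝ E] [MeasurableSpace E] [BorelSpace E] in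
/-- At the pole the test function equals `1` (`R > 0`). -/
theorem expMoment_test_center {R : ℝ} (hR : 0 < R) (α x₀ : E) :
    cutoff R (x₀ - x₀) * Real.exp ⟪α, x₀ - x₀⟫ = 1 := by
  rw [sub_self, cutoff_eq_one hR (by rw [norm_zero]; exact hR.le), inner_zero_right,
    Real.exp_zero, mul_one]

omit [FiniteDimensional ℝ E] [MeasurableSpace E] [BorelSpace E] in
/-- `0 ≤ φ_R ≤ e^{⟨α, · − x₀⟩}`. -/
theorem expMoment_test_nonneg_le (R : ℝ) (α x₀ x : E) :
    0 ≤ cutoff R (x - x₀) * Real.exp ⟪α, x - x₀⟫ ∧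
      cutoff R (x - x₀) * Real.exp ⟪α, x - x₀⟫ ≤ Real.exp ⟪α, x - x₀⟫ :=
  ⟨mul_nonneg (cutoff_nonneg _ _) (Real.exp_pos _).le,
    mul_le_of_le_one_left (Real.exp_pos _).le (cutoff_le_one _ _)⟩

omit [FiniteDimensional ℝ E] [MeasurableSpace E] [BorelSpace E] in
/-- The derivative of the test function:
`Dφ_R(x) = χ_R(x − x₀) e^{⟨α, x − x₀⟩} ⟨α, ·⟩ + e^{⟨α, x − x₀⟩} Dχ_R(x − x₀)`. -/
theorem expMoment_test_hasFDerivAt (R : ℝ) (α x₀ x : E) :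
    HasFDerivAt (fun x : E => cutoff R (x - x₀) * Real.exp ⟪α, x - x₀⟫)
      (cutoff R (x - x₀) • (Real.exp ⟪α, x - x₀⟫ • innerSL ℝ α) +
        Real.exp ⟪α, x - x₀⟫ • fderiv ℝ (cutoff R) (x - x₀)) x := by
  have h1 : HasFDerivAt (fun x : E => cutoff R (x - x₀)) (fderiv ℝ (cutoff R) (x - x₀)) x :=
    (hasFDerivAt_comp_sub x₀).2
      (((contDiff_cutoff (n := 1) R).differentiable one_ne_zero) (x - x₀)).hasFDerivAt
  exact h1.mul (expMoment_hasFDerivAt_exp_inner α x₀ x)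

omit [FiniteDimensional ℝ E] [MeasurableSpace E] [BorelSpace E] in
/-- The directional derivative of the test function:
`Dφ_R(x)(w) = e^{⟨α, x − x₀⟩} (χ_R(x − x₀) ⟨α, w⟩ + Dχ_R(x − x₀)(w))`. -/
theorem expMoment_test_fderiv_apply (R : ℝ) (α x₀ x w : E) :
    fderiv ℝ (fun x : E => cutoff R (x - x₀) * Real.exp ⟪α, x - x₀⟫) x w =
      Real.exp ⟪α, x - x₀⟫ * (cutoff R (x - x₀) * ⟪α, w⟫ + fderiv ℝ (cutoff R) (x - x₀) w) := by
  rw [(expMoment_test_hasFDerivAt R α x₀ x).fderiv]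
  simp only [_root_.add_apply, _root_.FunLike.coe_smul, Pi.smul_apply, innerSL_apply_apply,
    smul_eq_mul]
  ring

omit [MeasurableSpace E] [BorelSpace E] in
/-- The Laplacian of the test function:
`Δφ_R(x) = e^{⟨α, x − x₀⟩} (χ_R ‖α‖² + Δχ_R + 2 Dχ_R(α))(x − x₀)` (Leibniz rule for the
Laplacian; the cross term `2 Σᵢ ∂ᵢχ_R ∂ᵢe^{⟨α, ·⟩} = 2 e^{⟨α, ·⟩} Dχ_R(α)`). -/
theorem expMoment_test_laplacian (R : ℝ) (α x₀ x : E) :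
    (Δ (fun x : E => cutoff R (x - x₀) * Real.exp ⟪α, x - x₀⟫)) x =
      Real.exp ⟪α, x - x₀⟫ * (cutoff R (x - x₀) * ‖α‖ ^ 2 + (Δ (cutoff R : E → ℝ)) (x - x₀) +
        2 * fderiv ℝ (cutoff R) (x - x₀) α) := by
  set b := stdOrthonormalBasis ℝ E
  have hf : ContDiff ℝ 2 (fun x : E => cutoff R (x - x₀)) :=
    (contDiff_cutoff (n := 2) R).comp (contDiff_id.sub contDiff_const)
  have hg : ContDiff ℝ 2 (fun x : E => Real.exp ⟪α, x - x₀⟫) := expMoment_contDiff_exp_inner α x₀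
  have h1 : (Δ (fun x : E => cutoff R (x - x₀))) x = (Δ (cutoff R : E → ℝ)) (x - x₀) := by
    rw [InnerProductSpace.laplacian_eq_iteratedFDeriv_stdOrthonormalBasis,
      InnerProductSpace.laplacian_eq_iteratedFDeriv_stdOrthonormalBasis]
    simp only [iteratedFDeriv_comp_sub]
  rw [laplacian_mul_eq b hf hg x, h1, expMoment_laplacian_exp_inner α x₀ x]
  have h3 : ∀ i, fderiv ℝ (fun x : E => cutoff R (x - x₀)) x (b i) =
      fderiv ℝ (cutoff R) (x - x₀) (b i) := fun i => by
    rw [fderiv_comp_sub (f := cutoff R) x₀]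
  have h4 : ∀ i, fderiv ℝ (fun x : E => Real.exp ⟪α, x - x₀⟫) x (b i) =
      Real.exp ⟪α, x - x₀⟫ * ⟪α, b i⟫ := fun i => by
    rw [(expMoment_hasFDerivAt_exp_inner α x₀ x).fderiv]
    simp only [_root_.FunLike.coe_smul, Pi.smul_apply, innerSL_apply_apply, smul_eq_mul]
  have h5 : ∑ i, fderiv ℝ (fun x : E => cutoff R (x - x₀)) x (b i) *
      fderiv ℝ (fun x : E => Real.exp ⟪α, x - x₀⟫) x (b i) =
        Real.exp ⟪α, x - x₀⟫ * fderiv ℝ (cutoff R) (x - x₀) α := by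
    simp_rw [h3, h4]
    calc ∑ i, fderiv ℝ (cutoff R) (x - x₀) (b i) * (Real.exp ⟪α, x - x₀⟫ * ⟪α, b i⟫)
        = Real.exp ⟪α, x - x₀⟫ * ∑ i, fderiv ℝ (cutoff R) (x - x₀) (⟪b i, α⟫ • b i) := by
          rw [Finset.mul_sum]
          refine Finset.sum_congr rfl fun i _ => ?_
          rw [map_smul, smul_eq_mul, real_inner_comm α (b i)]
          ring
      _ = Real.exp ⟪α, x - x₀⟫ * fderiv ℝ (cutoff R) (x - x₀) α := by
          rw [← map_sum, b.sum_repr' α]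
  rw [h5]
  ring

omit [MeasurableSpace E] [BorelSpace E] in
/-- **Pointwise lower bound for the first variation of the test function.** For `ν ≥ 0` and
every direction `w`,
`Dφ_R(x)(w) − νΔφ_R(x) ≥ −(‖α‖‖w‖ + ν‖α‖²) φ_R(x)
  − e^{⟨α, x − x₀⟩} (‖Dχ_R(x − x₀)‖ (‖w‖ + 2ν‖α‖) + ν |Δχ_R(x − x₀)|)`
(`⟨α, w⟩ ≥ −‖α‖‖w‖`, `|Dχ_R(v)| ≤ ‖Dχ_R‖‖v‖`, `χ_R ≥ 0`). -/
theorem expMoment_test_pointwise {ν : ℝ} (hν : 0 ≤ ν) (R : ℝ) (α x₀ x w : E) :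
    -(‖α‖ * ‖w‖ + ν * ‖α‖ ^ 2) * (cutoff R (x - x₀) * Real.exp ⟪α, x - x₀⟫) -
        Real.exp ⟪α, x - x₀⟫ * (‖fderiv ℝ (cutoff R) (x - x₀)‖ * (‖w‖ + 2 * ν * ‖α‖) +
          ν * |(Δ (cutoff R : E → ℝ)) (x - x₀)|) ≤
      fderiv ℝ (fun x : E => cutoff R (x - x₀) * Real.exp ⟪α, x - x₀⟫) x w -
        ν * (Δ (fun x : E => cutoff R (x - x₀) * Real.exp ⟪α, x - x₀⟫)) x := by
  rw [expMoment_test_fderiv_apply, expMoment_test_laplacian]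
  set ex := Real.exp ⟪α, x - x₀⟫ with hex_def
  set χ := cutoff R (x - x₀) with hχ_def
  set D := fderiv ℝ (cutoff R) (x - x₀) with hD_def
  set L := (Δ (cutoff R : E → ℝ)) (x - x₀) with hL_def
  have hex : 0 < ex := Real.exp_pos _
  have hχ : 0 ≤ χ := cutoff_nonneg _ _
  have h1 : |⟪α, w⟫| ≤ ‖α‖ * ‖w‖ := abs_real_inner_le_norm α w
  have h2 : |D w| ≤ ‖D‖ * ‖w‖ := by rw [← Real.norm_eq_abs]; exact D.le_opNorm w
  have h3 : |D α| ≤ ‖D‖ * ‖α‖ := by rw [← Real.norm_eq_abs]; exact D.le_opNorm α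
  rw [abs_le] at h1 h2 h3
  have hA : 0 ≤ χ * (⟪α, w⟫ + ‖α‖ * ‖w‖) := mul_nonneg hχ (by linarith)
  have hC : 0 ≤ ν * (|L| - L) := mul_nonneg hν (sub_nonneg.2 (le_abs_self L))
  have hD' : 0 ≤ ν * (‖D‖ * ‖α‖ - D α) := mul_nonneg hν (by linarith)
  have key : 0 ≤ (χ * ⟪α, w⟫ + D w - ν * (χ * ‖α‖ ^ 2 + L + 2 * D α)) +
      ((‖α‖ * ‖w‖ + ν * ‖α‖ ^ 2) * χ + (‖D‖ * (‖w‖ + 2 * ν * ‖α‖) + ν * |L|)) := by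
    nlinarith
  nlinarith [mul_nonneg hex.le key]

omit [MeasurableSpace E] [BorelSpace E] in
/-- The pointwise lower bound with a drift bound `‖w‖ ≤ B`:
`Dφ_R(x)(w) − νΔφ_R(x) ≥ −(‖α‖B + ν‖α‖²) φ_R(x)
  − e^{⟨α, x − x₀⟩} (‖Dχ_R(x − x₀)‖ (B + 2ν‖α‖) + ν |Δχ_R(x − x₀)|)`. -/
theorem expMoment_test_pointwise_of_norm_le {ν B : ℝ} (hν : 0 ≤ ν) (R : ℝ) (α x₀ x : E) {w : E}
    (hw : ‖w‖ ≤ B) :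
    -(‖α‖ * B + ν * ‖α‖ ^ 2) * (cutoff R (x - x₀) * Real.exp ⟪α, x - x₀⟫) -
        Real.exp ⟪α, x - x₀⟫ * (‖fderiv ℝ (cutoff R) (x - x₀)‖ * (B + 2 * ν * ‖α‖) +
          ν * |(Δ (cutoff R : E → ℝ)) (x - x₀)|) ≤
      fderiv ℝ (fun x : E => cutoff R (x - x₀) * Real.exp ⟪α, x - x₀⟫) x w -
        ν * (Δ (fun x : E => cutoff R (x - x₀) * Real.exp ⟪α, x - x₀⟫)) x := by
  refine le_trans ?_ (expMoment_test_pointwise hν R α x₀ x w)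
  have hφ0 := (expMoment_test_nonneg_le R α x₀ x).1
  have e1 := mul_le_mul_of_nonneg_right hw
    (mul_nonneg (norm_nonneg α) hφ0 : 0 ≤ ‖α‖ * (cutoff R (x - x₀) * Real.exp ⟪α, x - x₀⟫))
  have e2 := mul_le_mul_of_nonneg_right hw
    (mul_nonneg (Real.exp_pos ⟪α, x - x₀⟫).le (norm_nonneg (fderiv ℝ (cutoff R) (x - x₀))) :
      0 ≤ Real.exp ⟪α, x - x₀⟫ * ‖fderiv ℝ (cutoff R) (x - x₀)‖)
  nlinarith [e1, e2]

/-! ### The registered sub-goal: the pairing identity on `ℝ³` -/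

/-- **Registered sub-goal `expMoment_stub_pairing`** (the `ℝ³` form of `expMoment_pairing`, a
sub-goal of STUB `stub_expMoment`): for an open time interval `Ioo t₀ T`, a jointly smooth
divergence-free drift `b`, an adapted backward kernel `G` of `∂ₜ + b·∇ − νΔ` on `Ioo t₀ T` and a
compactly supported `C²` test function `φ`,
`d/ds ∫ φ G(s) = ∫ (Dφ·b(s) − νΔφ) G(s)` at every `s ∈ Ioo t₀ T`. -/
theorem expMoment_stub_pairing :
    ∀ (ν t₀ T : ℝ) (b : ℝ → EuclideanSpace ℝ (Fin 3) → EuclideanSpace ℝ (Fin 3)) (x₀ : EuclideanSpace ℝ (Fin 3)) (G : ℝ → EuclideanSpace ℝ (Fin 3) → ℝ) (φ : EuclideanSpace ℝ (Fin 3) → ℝ), IsSmoothSpaceTimeOn (Ioo t₀ T) b → (∀ t ∈ Ioo t₀ T, VectorCalculus.IsDivFree (b t)) → IsAdaptedBackwardKernel ν b (Ioo t₀ T) T x₀ G → ContDiff ℝ 2 φ → HasCompactSupport φ → ∀ s ∈ Ioo t₀ T, HasDerivAt (fun r => ∫ x, φ x * G r x) (∫ x, (fderiv ℝ φ x (b s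 x) - ν * (Δ φ) x) * G s x) s :=
  fun _ _ _ _ _ _ _ hb hdiv hG hφ hφc _ hs =>
    (expMoment_pairing isOpen_Ioo hb hdiv hG hφ hφc hs).2

end Summit.NavierStokesRegularity.NavierStokesRegularity.Theorems.AdaptedKernelExists.NashEntropyLastBlock

end
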